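import Summits.MatrixMultiplication.MatrixMultiplication.Theorems.SubgroupIdentityDesigns.Negative.DecoratedSylowShapes

/-!
# Corner character sums (negative lemmas for the crux `SubgroupIdentityDesigns`,
# stmt-MatrixMultiplication-14079) — VALUE = THEOREM (all p), NOT summit progress.

The level-1 test space `F_1|_{GL_2(𝔽_p)}` is spanned by the functions `g ↦ ψ(tr(M g))`, `rk M ≤ 1`.
This file evaluates the character sums of these functions over the four `p²`-point "corner cells"

  `C(ε, δ) = {[[ε + x y, x δ], [y, δ]] : x, y ∈ 𝔽_p} = [[ε, *], [0, 1]] · [[1, 0], [*, δ]]`   and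
  `C'(ε, δ) = {[[ε, x], [y ε, x y + δ]] : x, y}     = [[1, 0], [*, δ]] · [[ε, *], [0, 1]]`,

in closed form (`corner_sum`, `corner_sum_rev`): for `det M = 0` the sum over `C(ε, δ)` depends on
`ε` alone or on `δ` alone (never on both), and likewise for `C'`.  Consequently the signed
combination over the `2 × 2` grid `{1, e} × {1, d}` vanishes identically (`corner_bracket`,
`corner_bracket_rev`): the function `+1` on `C(1,1) ∪ C(e,d)`, `-1` on `C(e,1) ∪ C(1,d)` is
ANNIHILATED by every level-1 test function.  `OppositeCorners.lean` turns this into an explicit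
pair-dependence certificate: no subgroup-TPP triple in which one member contains the `2p` matrices
`[[ε, x], [0, 1]]` (`ε ∈ {1, e}`) and a different member the `2p` matrices `[[1, 0], [y, δ]]`
(`δ ∈ {1, d}`), `e, d ≠ 1`, carries a level-1 identity design — for every prime `p`.
-/
set_option linter.dupNamespace false

noncomputable section

open scoped BigOperators Classical
open Summit.MatrixMultiplication.MatrixMultiplication.Theorems.LieRankDesigns.Negative
  (GLm Mat fourierFn)

namespace Summit.MatrixMultiplication.MatrixMultiplication.Theorems.SubgroupIdentityDesigns.Negative

section CornerSums

variable {p : ℕ} [hp : Fact p.Prime]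

/-- Orthogonality of additive characters: `Σ_x ψ(x z) = p·[z = 0]`. -/
theorem sum_psi_mul_right (z : ZMod p) :
    ∑ x : ZMod p, ZMod.stdAddChar (x * z) = if z = 0 then (p : ℂ) else 0 := by
  haveI : NeZero p := ⟨hp.out.ne_zero⟩
  rw [AddChar.sum_mulShift z (ZMod.isPrimitive_stdAddChar p), ZMod.card, Nat.cast_ite,
    Nat.cast_zero]

/-- The affine double sum `Σ_{x,y} ψ(K + P x + Q y) = ψ(K)·p[P = 0]·p[Q = 0]`. -/
theorem sum_psi_affine (K P Q : ZMod p) :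
    ∑ x : ZMod p, ∑ y : ZMod p, ZMod.stdAddChar (K + P * x + Q * y) =
      ZMod.stdAddChar K * ((if P = 0 then (p : ℂ) else 0) * (if Q = 0 then (p : ℂ) else 0)) := by
  have h : ∀ x y : ZMod p, ZMod.stdAddChar (K + P * x + Q * y) =
      ZMod.stdAddChar K * (ZMod.stdAddChar (x * P) * ZMod.stdAddChar (y * Q)) := by
    intro x y
    rw [← AddChar.map_add_eq_mul, ← AddChar.map_add_eq_mul]
    congr 1; ring
  simp_rw [h]
  rw [← sum_psi_mul_right P, ← sum_psi_mul_right Q, Finset.sum_mul_sum, Finset.mul_sum]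
  refine Finset.sum_congr rfl fun x _ => ?_
  rw [Finset.mul_sum]

/-- The bilinear double sum: for `L ≠ 0`, `Σ_{x,y} ψ(K + L x y + P x + Q y) = p·ψ(K - P Q / L)`
(complete the product and use orthogonality in `y`). -/
theorem sum_psi_bilinear {L : ZMod p} (hL : L ≠ 0) (K P Q : ZMod p) :
    ∑ x : ZMod p, ∑ y : ZMod p, ZMod.stdAddChar (K + L * x * y + P * x + Q * y) =
      (p : ℂ) * ZMod.stdAddChar (K - P * Q / L) := by
  have e1 : ∀ (A : ZMod p → ℂ) (c : ZMod p), ∑ x : ZMod p, A (x + c) = ∑ x : ZMod p, A x :=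
    fun A c => Equiv.sum_comp (Equiv.addRight c) A
  have h : ∀ x y : ZMod p, K + L * x * y + P * x + Q * y =
      (K - P * Q / L) + (y + P / L) * (L * (x + Q / L)) := by
    intro x y; field_simp; ring
  simp_rw [h]
  calc ∑ x : ZMod p, ∑ y : ZMod p,
        ZMod.stdAddChar ((K - P * Q / L) + (y + P / L) * (L * (x + Q / L)))
      = ∑ x : ZMod p, ∑ y : ZMod p, ZMod.stdAddChar ((K - P * Q / L) + y * (L * (x + Q / L))) := by
        refine Finset.sum_congr rfl fun x _ => ?_
        exact e1 (fun y => ZMod.stdAddChar ((K - P * Q / L) + y * (L * (x + Q / L)))) (P / L)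
    _ = ∑ x : ZMod p, ∑ y : ZMod p, ZMod.stdAddChar ((K - P * Q / L) + y * (L * x)) :=
        e1 (fun x => ∑ y : ZMod p, ZMod.stdAddChar ((K - P * Q / L) + y * (L * x))) (Q / L)
    _ = ∑ x : ZMod p, ZMod.stdAddChar (K - P * Q / L) * (if L * x = 0 then (p : ℂ) else 0) := by
        refine Finset.sum_congr rfl fun x _ => ?_
        simp_rw [AddChar.map_add_eq_mul]
        rw [← Finset.mul_sum, sum_psi_mul_right]
    _ = ∑ x : ZMod p, (if x = 0 then ZMod.stdAddChar (K - P * Q / L) * (p : ℂ) else 0) := by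
        refine Finset.sum_congr rfl fun x _ => ?_
        rcases eq_or_ne x 0 with rfl | hx
        · simp
        · rw [if_neg (mul_ne_zero hL hx), if_neg hx, mul_zero]
    _ = (p : ℂ) * ZMod.stdAddChar (K - P * Q / L) := by
        rw [Finset.sum_ite_eq']; simp [mul_comm]

/-- Trace against the corner cell `C(ε, δ)`. -/
theorem trace_corner (M : Mat p 2) (ε δ x y : ZMod p) :
    Matrix.trace (M * !![ε + x * y, x * δ; y, δ]) =
      (M 0 0 * ε + M 1 1 * δ) + M 0 0 * x * y + (M 1 0 * δ) * x + M 0 1 * y := by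
  simp [Matrix.trace_fin_two, Matrix.mul_apply, Fin.sum_univ_two]
  ring

/-- Trace against the reversed corner cell `C'(ε, δ)`. -/
theorem trace_corner_rev (M : Mat p 2) (ε δ x y : ZMod p) :
    Matrix.trace (M * !![ε, x; y * ε, x * y + δ]) =
      (M 0 0 * ε + M 1 1 * δ) + M 1 1 * x * y + M 1 0 * x + (M 0 1 * ε) * y := by
  simp [Matrix.trace_fin_two, Matrix.mul_apply, Fin.sum_univ_two]
  ring

/-- **Corner sum.**  For `det M = 0` and `δ ≠ 0` the level-1 character sum over `C(ε, δ)` is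
`p ψ(M₀₀ ε)` if `M₀₀ ≠ 0` (a function of `ε` alone) and `ψ(M₁₁ δ)·p[M₁₀ = 0]·p[M₀₁ = 0]`
otherwise (a function of `δ` alone). -/
theorem corner_sum (M : Mat p 2) (hM : M.det = 0) (ε : ZMod p) {δ : ZMod p} (hδ : δ ≠ 0) :
    ∑ x : ZMod p, ∑ y : ZMod p, ZMod.stdAddChar (Matrix.trace (M * !![ε + x * y, x * δ; y, δ])) =
      if M 0 0 = 0 then ZMod.stdAddChar (M 1 1 * δ) *
          ((if M 1 0 = 0 then (p : ℂ) else 0) * (if M 0 1 = 0 then (p : ℂ) else 0))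
      else (p : ℂ) * ZMod.stdAddChar (M 0 0 * ε) := by
  simp_rw [trace_corner]
  by_cases h00 : M 0 0 = 0
  · rw [if_pos h00]
    have h : ∀ x y : ZMod p,
        (M 0 0 * ε + M 1 1 * δ) + M 0 0 * x * y + (M 1 0 * δ) * x + M 0 1 * y
          = M 1 1 * δ + (M 1 0 * δ) * x + M 0 1 * y := by
      intro x y; rw [h00]; ring
    simp_rw [h, sum_psi_affine]
    rcases eq_or_ne (M 1 0) 0 with h10 | h10
    · rw [h10, zero_mul, if_pos rfl]
    · rw [if_neg (mul_ne_zero h10 hδ), if_neg h10]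
  · rw [if_neg h00, sum_psi_bilinear h00]
    congr 2
    rw [Matrix.det_fin_two] at hM
    field_simp
    linear_combination δ * hM

/-- **Reversed corner sum** (over `C'(ε, δ)`, `ε ≠ 0`): `p ψ(M₁₁ δ)` if `M₁₁ ≠ 0`, else
`ψ(M₀₀ ε)·p[M₁₀ = 0]·p[M₀₁ = 0]`. -/
theorem corner_sum_rev (M : Mat p 2) (hM : M.det = 0) {ε : ZMod p} (hε : ε ≠ 0) (δ : ZMod p) :
    ∑ x : ZMod p, ∑ y : ZMod p, ZMod.stdAddChar (Matrix.trace (M * !![ε, x; y * ε, x * y + δ])) =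
      if M 1 1 = 0 then ZMod.stdAddChar (M 0 0 * ε) *
          ((if M 1 0 = 0 then (p : ℂ) else 0) * (if M 0 1 = 0 then (p : ℂ) else 0))
      else (p : ℂ) * ZMod.stdAddChar (M 1 1 * δ) := by
  simp_rw [trace_corner_rev]
  by_cases h11 : M 1 1 = 0
  · rw [if_pos h11]
    have h : ∀ x y : ZMod p,
        (M 0 0 * ε + M 1 1 * δ) + M 1 1 * x * y + M 1 0 * x + (M 0 1 * ε) * y
          = M 0 0 * ε + M 1 0 * x + (M 0 1 * ε) * y := by
      intro x y; rw [h11]; ring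
    simp_rw [h, sum_psi_affine]
    rcases eq_or_ne (M 0 1) 0 with h01 | h01
    · rw [h01, zero_mul, if_pos rfl]
    · rw [if_neg (mul_ne_zero h01 hε), if_neg h01]
  · rw [if_neg h11, sum_psi_bilinear h11]
    congr 2
    rw [Matrix.det_fin_two] at hM
    field_simp
    linear_combination ε * hM

/-- **Corner bracket**: the signed sum over the grid `{1, e} × {1, d}` of the corner sums vanishes
for every singular `M` (`d ≠ 0`). -/
theorem corner_bracket (M : Mat p 2) (hM : M.det = 0) (e : ZMod p) {d : ZMod p} (hd : d ≠ 0) :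
    (∑ x : ZMod p, ∑ y : ZMod p,
        ZMod.stdAddChar (Matrix.trace (M * !![1 + x * y, x * 1; y, 1])))
      - (∑ x : ZMod p, ∑ y : ZMod p,
        ZMod.stdAddChar (Matrix.trace (M * !![e + x * y, x * 1; y, 1])))
      - (∑ x : ZMod p, ∑ y : ZMod p,
        ZMod.stdAddChar (Matrix.trace (M * !![1 + x * y, x * d; y, d])))
      + (∑ x : ZMod p, ∑ y : ZMod p,
        ZMod.stdAddChar (Matrix.trace (M * !![e + x * y, x * d; y, d]))) = 0 := by
  rw [corner_sum M hM 1 one_ne_zero, corner_sum M hM e one_ne_zero, corner_sum M hM 1 hd,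
    corner_sum M hM e hd]
  split_ifs <;> ring

/-- **Reversed corner bracket** (`e ≠ 0`). -/
theorem corner_bracket_rev (M : Mat p 2) (hM : M.det = 0) {e : ZMod p} (he : e ≠ 0) (d : ZMod p) :
    (∑ x : ZMod p, ∑ y : ZMod p,
        ZMod.stdAddChar (Matrix.trace (M * !![1, x; y * 1, x * y + 1])))
      - (∑ x : ZMod p, ∑ y : ZMod p,
        ZMod.stdAddChar (Matrix.trace (M * !![e, x; y * e, x * y + 1])))
      - (∑ x : ZMod p, ∑ y : ZMod p,
        ZMod.stdAddChar (Matrix.trace (M * !![1, x; y * 1, x * y + d])))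
      + (∑ x : ZMod p, ∑ y : ZMod p,
        ZMod.stdAddChar (Matrix.trace (M * !![e, x; y * e, x * y + d]))) = 0 := by
  rw [corner_sum_rev M hM one_ne_zero 1, corner_sum_rev M hM he 1,
    corner_sum_rev M hM one_ne_zero d, corner_sum_rev M hM he d]
  split_ifs <;> ring

/-! ### Pushing an indicator sum through a level-1 test function -/

/-- A `2 × 2` matrix with non-zero determinant has rank `> 1`. -/
theorem one_lt_rank_of_det_ne_zero (M : Mat p 2) (h : M.det ≠ 0) : 1 < M.rank := by
  have hu : IsUnit M := (Matrix.isUnit_iff_isUnit_det M).mpr (isUnit_iff_ne_zero.mpr h)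
  rw [Matrix.rank_of_isUnit M hu, Fintype.card_fin]
  norm_num

/-- Summing an indicator of a fixed invertible matrix against a function on `GL₂` evaluates it. -/
theorem sum_ite_coe_eq (A : Mat p 2) (hA : A.det ≠ 0) (F : GLm p 2 → ℂ) :
    ∑ g : GLm p 2, (if (g : Mat p 2) = A then F g else 0) =
      F (Matrix.GeneralLinearGroup.mkOfDetNeZero A hA) := by
  rw [Finset.sum_eq_single (Matrix.GeneralLinearGroup.mkOfDetNeZero A hA)]
  · rw [if_pos (show ((Matrix.GeneralLinearGroup.mkOfDetNeZero A hA : GLm p 2) : Mat p 2) = A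
      from rfl)]
  · intro g _ hg
    rw [if_neg]
    intro h
    exact hg (Units.ext h)
  · intro h; exact absurd (Finset.mem_univ _) h

/-- **Push-forward through a corner cell**: the indicator sum of `C(ε, δ)` (`ε δ ≠ 0`) paired with
the Fourier function of a coefficient table `c` is `Σ_M c(M) · Σ_{x,y} ψ(tr(M · C(ε,δ)(x,y)))`. -/
theorem corner_push (ε δ : ZMod p) (h : ε * δ ≠ 0) (c : Mat p 2 → ℂ) :
    ∑ g : GLm p 2, (∑ x : ZMod p, ∑ y : ZMod p,
        if (g : Mat p 2) = !![ε + x * y, x * δ; y, δ] then (1 : ℂ) else 0) * fourierFn c g =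
      ∑ M : Mat p 2, c M * ∑ x : ZMod p, ∑ y : ZMod p,
        ZMod.stdAddChar (Matrix.trace (M * !![ε + x * y, x * δ; y, δ])) := by
  have hdet : ∀ x y : ZMod p, Matrix.det !![ε + x * y, x * δ; y, δ] ≠ 0 := by
    intro x y; rw [Matrix.det_fin_two_of]; convert h using 1; ring
  calc ∑ g : GLm p 2, (∑ x : ZMod p, ∑ y : ZMod p,
          if (g : Mat p 2) = !![ε + x * y, x * δ; y, δ] then (1 : ℂ) else 0) * fourierFn c g
      = ∑ x : ZMod p, ∑ y : ZMod p, ∑ g : GLm p 2,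
          (if (g : Mat p 2) = !![ε + x * y, x * δ; y, δ] then fourierFn c g else 0) := by
        simp_rw [Finset.sum_mul, ite_mul, one_mul, zero_mul]
        rw [Finset.sum_comm]
        exact Finset.sum_congr rfl fun x _ => Finset.sum_comm
    _ = ∑ x : ZMod p, ∑ y : ZMod p, ∑ M : Mat p 2,
          c M * ZMod.stdAddChar (Matrix.trace (M * !![ε + x * y, x * δ; y, δ])) := by
        refine Finset.sum_congr rfl fun x _ => Finset.sum_congr rfl fun y _ => ?_
        rw [sum_ite_coe_eq _ (hdet x y)]
        rfl
    _ = ∑ M : Mat p 2, c M * ∑ x : ZMod p, ∑ y : ZMod p,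
          ZMod.stdAddChar (Matrix.trace (M * !![ε + x * y, x * δ; y, δ])) := by
        have hc : ∀ x : ZMod p, (∑ y : ZMod p, ∑ M : Mat p 2,
            c M * ZMod.stdAddChar (Matrix.trace (M * !![ε + x * y, x * δ; y, δ]))) =
            ∑ M : Mat p 2, ∑ y : ZMod p,
              c M * ZMod.stdAddChar (Matrix.trace (M * !![ε + x * y, x * δ; y, δ])) :=
          fun x => Finset.sum_comm
        simp_rw [hc]
        rw [Finset.sum_comm]
        refine Finset.sum_congr rfl fun M _ => ?_
        rw [Finset.mul_sum]
        refine Finset.sum_congr rfl fun x _ => ?_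
        rw [Finset.mul_sum]

/-- **Push-forward through a reversed corner cell** `C'(ε, δ)` (`ε δ ≠ 0`). -/
theorem corner_push_rev (ε δ : ZMod p) (h : ε * δ ≠ 0) (c : Mat p 2 → ℂ) :
    ∑ g : GLm p 2, (∑ x : ZMod p, ∑ y : ZMod p,
        if (g : Mat p 2) = !![ε, x; y * ε, x * y + δ] then (1 : ℂ) else 0) * fourierFn c g =
      ∑ M : Mat p 2, c M * ∑ x : ZMod p, ∑ y : ZMod p,
        ZMod.stdAddChar (Matrix.trace (M * !![ε, x; y * ε, x * y + δ])) := by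
  have hdet : ∀ x y : ZMod p, Matrix.det !![ε, x; y * ε, x * y + δ] ≠ 0 := by
    intro x y; rw [Matrix.det_fin_two_of]; convert h using 1; ring
  calc ∑ g : GLm p 2, (∑ x : ZMod p, ∑ y : ZMod p,
          if (g : Mat p 2) = !![ε, x; y * ε, x * y + δ] then (1 : ℂ) else 0) * fourierFn c g
      = ∑ x : ZMod p, ∑ y : ZMod p, ∑ g : GLm p 2,
          (if (g : Mat p 2) = !![ε, x; y * ε, x * y + δ] then fourierFn c g else 0) := by
        simp_rw [Finset.sum_mul, ite_mul, one_mul, zero_mul]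
        rw [Finset.sum_comm]
        exact Finset.sum_congr rfl fun x _ => Finset.sum_comm
    _ = ∑ x : ZMod p, ∑ y : ZMod p, ∑ M : Mat p 2,
          c M * ZMod.stdAddChar (Matrix.trace (M * !![ε, x; y * ε, x * y + δ])) := by
        refine Finset.sum_congr rfl fun x _ => Finset.sum_congr rfl fun y _ => ?_
        rw [sum_ite_coe_eq _ (hdet x y)]
        rfl
    _ = ∑ M : Mat p 2, c M * ∑ x : ZMod p, ∑ y : ZMod p,
          ZMod.stdAddChar (Matrix.trace (M * !![ε, x; y * ε, x * y + δ])) := by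
        have hc : ∀ x : ZMod p, (∑ y : ZMod p, ∑ M : Mat p 2,
            c M * ZMod.stdAddChar (Matrix.trace (M * !![ε, x; y * ε, x * y + δ]))) =
            ∑ M : Mat p 2, ∑ y : ZMod p,
              c M * ZMod.stdAddChar (Matrix.trace (M * !![ε, x; y * ε, x * y + δ])) :=
          fun x => Finset.sum_comm
        simp_rw [hc]
        rw [Finset.sum_comm]
        refine Finset.sum_congr rfl fun M _ => ?_
        rw [Finset.mul_sum]
        refine Finset.sum_congr rfl fun x _ => ?_
        rw [Finset.mul_sum]

end CornerSums

end Summit.MatrixMultiplication.MatrixMultiplication.Theorems.SubgroupIdentityDesigns.Negative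

end
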